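import Mathlib
import Summits.NavierStokesRegularity.NavierStokesRegularity.Theses.AmplitudeIndex
import Literature.Analysis.FluidPDE.VorticityCalculus
import HarnessLib

/-!
# `AmplitudeIndex.LiouvilleImpliesStable` — KNSS's Liouville conjecture (L) makes every Type-I
  ancient mild solution irrotational (route `AmplitudeIndex`, item stmt-NavierStokesRegularity-10565,
  support; "(L) ⇒ (S)")

**Statement.** Assume (L): every bounded ancient mild solution (`ν = 1`) with a.e.-strongly
measurable slices has a.e.-constant slices. Then every ancient mild solution `v`, smooth on
`(−∞, 0) × ℝ³`, with Type-I time decay `‖v(t,x)‖ ≤ C/√(−t)` (and whatever stability property —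
unused) has `curl v(t) ≡ 0` for all `t < 0`.

PROOF (as in the item text). Fix `t < 0` and shift time by `s = t/2 ≤ 0`: `u(τ) = v(τ + s)` is an
ancient mild solution (`IsAncientMildSolution.time_translate`), bounded on `τ < 0` by `|C|/√(−s)`
(Type-I decay, `−(τ + s) ≥ −s`), with continuous hence measurable slices. By (L) the slice
`u(t − s) = v(t)` is a.e. a constant `b`; being continuous it IS the constant (`Continuous.ae_eq_iff_eq`),
so its derivative and its curl vanish (`curl_eq_zero_of_fderiv_eq_zero`).

HONEST FRAMING: a conditional statement ((L) is an open conjecture, here a hypothesis); nothing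
here bears on the regularity problem itself.
-/

noncomputable section

set_option linter.dupNamespace false

namespace Summit.NavierStokesRegularity.NavierStokesRegularity.Theorems

open MeasureTheory Set Filter Topology Function
open Literature.Analysis Literature.Analysis.FluidPDE

/-- **Item stmt-NavierStokesRegularity-10565** (`AmplitudeIndex.LiouvilleImpliesStable`): under
KNSS's Liouville conjecture (L), a smooth ancient mild solution with Type-I time decay is
irrotational on `t < 0` (time shift + (L) + continuity of the slices). [this file; KNSS2009 §1] -/
theorem amplitudeIndex_liouvilleImpliesStable_proof :
    Summit.NavierStokesRegularity.NavierStokesRegularity.Theses.AmplitudeIndex.LiouvilleImpliesStable := by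
  unfold Summit.NavierStokesRegularity.NavierStokesRegularity.Theses.AmplitudeIndex.LiouvilleImpliesStable
  intro hL v hv hsmooth hdecay _hstable t ht x
  obtain ⟨C, hC⟩ := hdecay
  -- continuity of the slices of `v`
  have hcont : ContinuousOn (uncurry v) (Iio 0 ×ˢ univ) := hsmooth.continuousOn
  have hslice : ∀ τ < 0, Continuous (v τ) := fun τ hτ =>
    hcont.comp_continuous (Continuous.prodMk_right τ) fun y => ⟨hτ, mem_univ y⟩
  -- the time shift by `s = t/2`
  set s : ℝ := t / 2 with hs
  have hs0 : s ≤ 0 := by rw [hs]; linarith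
  have hsneg : s < 0 := by rw [hs]; linarith
  set u : ℝ → EuclideanSpace ℝ (Fin 3) → EuclideanSpace ℝ (Fin 3) := fun τ => v (τ + s) with hu
  have hua : IsAncientMildSolution 1 u := hv.time_translate hs0
  have hub : IsBoundedAncientMildSolution 1 u := by
    refine ⟨hua, |C| / Real.sqrt (-s), fun τ hτ y => ?_⟩
    have hτs : τ + s < 0 := by
      have : τ < 0 := hτ
      linarith
    have h1 := hC (τ + s) hτs y
    have hsq : Real.sqrt (-s) ≤ Real.sqrt (-(τ + s)) := Real.sqrt_le_sqrt (by
      have : τ < 0 := hτ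
      linarith)
    have hsqpos : 0 < Real.sqrt (-s) := Real.sqrt_pos.2 (by linarith)
    calc ‖u τ y‖ = ‖v (τ + s) y‖ := rfl
      _ ≤ C / Real.sqrt (-(τ + s)) := h1
      _ ≤ |C| / Real.sqrt (-(τ + s)) :=
          div_le_div_of_nonneg_right (le_abs_self C) (Real.sqrt_nonneg _)
      _ ≤ |C| / Real.sqrt (-s) := div_le_div_of_nonneg_left (abs_nonneg C) hsqpos hsq
  have hum : ∀ τ < 0, AEStronglyMeasurable (u τ) volume := fun τ hτ =>
    (hslice (τ + s) (by linarith)).aestronglyMeasurable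
  -- (L) at the time `t − s < 0`: the slice `u (t − s) = v t` is a.e. constant
  have hts : t - s < 0 := by rw [hs]; linarith
  obtain ⟨b, hb⟩ := hL u hub hum (t - s) hts
  have huts : u (t - s) = v t := by simp only [hu, sub_add_cancel]
  rw [huts] at hb
  have hvt : v t = fun _ => b := ((hslice t ht).ae_eq_iff_eq volume continuous_const).1 hb
  -- a constant field is irrotational
  refine curl_eq_zero_of_fderiv_eq_zero ?_
  rw [hvt]
  simp

end Summit.NavierStokesRegularity.NavierStokesRegularity.Theorems

end
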